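import Summits.QuantumAdvantage.QuantumAdvantage.Theorems.LinnikCubicClassGroupsDegreeOnePrimesEscapeConjClassCount
import Summits.QuantumAdvantage.QuantumAdvantage.Theorems.LinnikCubicClassGroupsDegreeOnePrimesEscapeFrobeniusDegOneCounting
import Summits.QuantumAdvantage.QuantumAdvantage.Theorems.LinnikCubicClassGroupsDegreeOnePrimesEscapeQuarticS4Count
import HarnessLib

/-!
# From the Frobenius-weighted `ψ` of `E = N^H` to the rational primes with Frobenius class `C(σ)`

Topic `Summits/QuantumAdvantage/QuantumAdvantage/Theorems`, cell B2b-1 (linnik-cubic), PART A (gen 13); helper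
toward the crux `DegreeOnePrimesEscape` (stmt-QuantumAdvantage-11543) — step B6 of the LMO programme
(descent to conjugacy classes), the prime bookkeeping.  HONEST FRAMING: the value of this file is a THEOREM
(kernel-checked) — NOT summit progress.

Let `N/ℚ` be Galois with group `G`, `E` an intermediate field with `Gal(N/E)` abelian of order `m`, `σ ∈ Gal(N/E)`,
and `ψ_σ(x) = Σ_{N𝔭^k ≤ x, 𝔭 unramified in N, Frob_𝔭^k = σ} log N𝔭` the Frobenius-weighted Chebyshev function
of `E` (the weight `w_σ` of `frobeniusPsi_dichotomy`).  Let
`S_C(x) = Σ_{p ≤ x, p ∤ d_N, Frob_p ∈ C(σ)} log p`, where `Frob_p ∈ C(σ)` means: some prime `Q ∣ p` of `N`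
with trivial inertia has an arithmetic Frobenius conjugate to `σ`.

* `psiWeighted_degOne_sandwich` — `0 ≤ ψ_w(x) − A_w(x) ≤ (ψ_E − θ_E)(x) + Σ_{N𝔭 ≤ x not prime} log N𝔭
  + Σ_{N𝔭 = p ∣ d_N} log N𝔭`, where `A_w(x) = Σ_{N𝔭 = p ≤ x prime, p ∤ d_N} w(𝔭) log p` (any weight
  `0 ≤ w ≤ 1`);
* `card_aut_mul_degOneSum_eq` — **Deuring's reduction, summed**: `m · A_{w_σ}(x) = |C_G(σ)| · S_C(x)`
  (`card_aut_mul_card_degOneFrobPrimes_eq` prime by prime, and `#{g : g φ g⁻¹ = σ} = |C_G(σ)|·𝟙[φ ∼ σ]`);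
* `abs_card_mul_psiFrob_sub_le` — hence
  `|m ψ_σ(x) − |C_G(σ)| S_C(x)| ≤ m((ψ_E − θ_E)(x) + [E:ℚ](√x + 1) log x + [E:ℚ] ω(d_N) log|d_N|)`.

References: [LagariasMontgomeryOdlyzko1979, §3 (reduction to `L/L^{⟨σ⟩}`), §9].
-/

noncomputable section

open Finset Real NumberField IsDedekindDomain Ideal MulAction
open scoped NumberField nonZeroDivisors Classical Pointwise

namespace Summit.QuantumAdvantage.QuantumAdvantage.Theorems.DegreeOnePrimesEscape

open Literature.NumberTheory.LFunctions Literature.NumberTheory.LFunctions.NumberField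
  Literature.NumberTheory.NumberFields Literature.NumberTheory.GaloisRepresentations

/-! ### Group theory: `#{g : g φ g⁻¹ = σ}` -/

section GroupTheory

variable {G : Type*} [Group G]

/-- If `g₀ φ g₀⁻¹ = σ` then `{g : g φ g⁻¹ = σ}` is in bijection with the centraliser of `σ`. -/
theorem natCard_conj_eq_card_centralizer {φ σ g₀ : G} (h : g₀ * φ * g₀⁻¹ = σ) :
    Nat.card {g : G // g * φ * g⁻¹ = σ} = Nat.card (Subgroup.centralizer ({σ} : Set G)) := by
  refine Nat.card_congr
    { toFun := fun g => ⟨g.1 * g₀⁻¹, ?_⟩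
      invFun := fun z => ⟨z.1 * g₀, ?_⟩
      left_inv := fun g => Subtype.ext (by simp)
      right_inv := fun z => Subtype.ext (by simp) }
  · rw [Subgroup.mem_centralizer_singleton_iff]
    have hg := g.2
    calc g.1 * g₀⁻¹ * σ = g.1 * g₀⁻¹ * (g₀ * φ * g₀⁻¹) := by rw [h]
      _ = (g.1 * φ * g.1⁻¹) * (g.1 * g₀⁻¹) := by group
      _ = σ * (g.1 * g₀⁻¹) := by rw [hg]
  · have hz : z.1 * σ = σ * z.1 := Subgroup.mem_centralizer_singleton_iff.mp z.2
    show z.1 * g₀ * φ * (z.1 * g₀)⁻¹ = σ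
    calc z.1 * g₀ * φ * (z.1 * g₀)⁻¹ = z.1 * (g₀ * φ * g₀⁻¹) * z.1⁻¹ := by group
      _ = z.1 * σ * z.1⁻¹ := by rw [h]
      _ = σ * z.1 * z.1⁻¹ := by rw [hz]
      _ = σ := by group

/-- If no conjugate of `φ` equals `σ` then `#{g : g φ g⁻¹ = σ} = 0`. -/
theorem natCard_conj_eq_zero_of_forall {φ σ : G} (h : ∀ g : G, g * φ * g⁻¹ ≠ σ) :
    Nat.card {g : G // g * φ * g⁻¹ = σ} = 0 := by
  rw [Nat.card_eq_zero]
  exact Or.inl ⟨fun g => h g.1 g.2⟩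

/-- `|C_G(σ)| · |C(σ)| = |G|` (orbit–stabiliser for conjugation), in the form `1 ≤ |C_G(σ)| ≤ |G|`. -/
theorem card_centralizer_pos [Finite G] (σ : G) : 0 < Nat.card (Subgroup.centralizer ({σ} : Set G)) :=
  Nat.card_pos

/-- The same bijection, landing in the centraliser of `φ`: `g ↦ g₀⁻¹ g`. -/
theorem natCard_conj_eq_card_centralizer_left {φ σ g₀ : G} (h : g₀ * φ * g₀⁻¹ = σ) :
    Nat.card {g : G // g * φ * g⁻¹ = σ} = Nat.card (Subgroup.centralizer ({φ} : Set G)) := by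
  refine Nat.card_congr
    { toFun := fun g => ⟨g₀⁻¹ * g.1, ?_⟩
      invFun := fun z => ⟨g₀ * z.1, ?_⟩
      left_inv := fun g => Subtype.ext (by simp)
      right_inv := fun z => Subtype.ext (by simp) }
  · rw [Subgroup.mem_centralizer_singleton_iff]
    have hg := g.2
    have h1 : g₀⁻¹ * g.1 * φ * (g₀⁻¹ * g.1)⁻¹ = φ := by
      calc g₀⁻¹ * g.1 * φ * (g₀⁻¹ * g.1)⁻¹ = g₀⁻¹ * (g.1 * φ * g.1⁻¹) * g₀ := by group
        _ = g₀⁻¹ * σ * g₀ := by rw [hg]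
        _ = g₀⁻¹ * (g₀ * φ * g₀⁻¹) * g₀ := by rw [h]
        _ = φ := by group
    calc g₀⁻¹ * g.1 * φ = g₀⁻¹ * g.1 * φ * (g₀⁻¹ * g.1)⁻¹ * (g₀⁻¹ * g.1) := by group
      _ = φ * (g₀⁻¹ * g.1) := by rw [h1]
  · have hz : z.1 * φ = φ * z.1 := Subgroup.mem_centralizer_singleton_iff.mp z.2
    show g₀ * z.1 * φ * (g₀ * z.1)⁻¹ = σ
    calc g₀ * z.1 * φ * (g₀ * z.1)⁻¹ = g₀ * (z.1 * φ) * z.1⁻¹ * g₀⁻¹ := by group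
      _ = g₀ * (φ * z.1) * z.1⁻¹ * g₀⁻¹ := by rw [hz]
      _ = g₀ * φ * g₀⁻¹ := by group
      _ = σ := h

/-- **Orbit–stabiliser for conjugation**: `|C(σ)| · |C_G(σ)| = |G|`, with `C(σ) = {τ : IsConj σ τ}` the
conjugacy class of `σ`. -/
theorem card_isConj_mul_card_centralizer [Finite G] (σ : G) :
    Nat.card {τ : G // IsConj σ τ} * Nat.card (Subgroup.centralizer ({σ} : Set G)) = Nat.card G := by
  classical
  letI := Fintype.ofFinite G
  set f : G → {τ : G // IsConj σ τ} := fun g => ⟨g * σ * g⁻¹, isConj_iff.mpr ⟨g, rfl⟩⟩ with hf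
  have hfib : ∀ τ : {τ : G // IsConj σ τ}, Nat.card {g : G // f g = τ} =
      Nat.card (Subgroup.centralizer ({σ} : Set G)) := by
    intro τ
    obtain ⟨g₀, hg₀⟩ := isConj_iff.mp τ.2
    have e : Nat.card {g : G // f g = τ} = Nat.card {g : G // g * σ * g⁻¹ = τ.1} := by
      refine Nat.card_congr (Equiv.subtypeEquivRight fun g => ?_)
      rw [hf, Subtype.ext_iff]
    rw [e]
    exact natCard_conj_eq_card_centralizer_left hg₀
  rw [← Nat.card_congr (Equiv.sigmaFiberEquiv f), Nat.card_sigma, Finset.sum_congr rfl (fun τ _ => hfib τ),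
    Finset.sum_const, smul_eq_mul, Finset.card_univ, ← Nat.card_eq_fintype_card]

end GroupTheory

/-! ### The Frobenius-weighted `ψ` versus its good degree-one part -/

section Primes

variable {N : Type} [Field N] [NumberField N] [IsGalois ℚ N]

omit [IsGalois ℚ N] in
/-- **Sandwich**: for a weight `0 ≤ w ≤ 1` on the ideals of `E` and `x ≥ 0`, writing
`A_w(x) = Σ_{N𝔭 ≤ x, N𝔭 = p prime, p ∤ d_N} w(𝔭) log N𝔭`,
`0 ≤ ψ_w(x) − A_w(x) ≤ (ψ_E − θ_E)(x) + Σ_{N𝔭 ≤ x not prime} log N𝔭 + Σ_{N𝔭 = p ∣ d_N, N𝔭 ≤ x} log N𝔭`. -/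
theorem psiWeighted_degOne_sandwich (E : IntermediateField ℚ N) {w : Ideal (𝓞 E) → ℝ}
    (hw0 : ∀ I, 0 ≤ w I) (hw1 : ∀ I, w I ≤ 1) {x : ℝ} (hx : 0 ≤ x) :
    0 ≤ (∑ n ∈ Icc 0 ⌊x⌋₊, ∑ I ∈ idealsOfNorm E n, w I * idealVonMangoldt I) -
        ∑ P ∈ (finite_primeIdealsLE E x).toFinset with
          ((Ideal.absNorm P).Prime ∧ ¬ ((Ideal.absNorm P : ℤ) ∣ NumberField.discr N)), w P * Real.log (Ideal.absNorm P : ℝ) ∧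
    (∑ n ∈ Icc 0 ⌊x⌋₊, ∑ I ∈ idealsOfNorm E n, w I * idealVonMangoldt I) -
        ∑ P ∈ (finite_primeIdealsLE E x).toFinset with
          ((Ideal.absNorm P).Prime ∧ ¬ ((Ideal.absNorm P : ℤ) ∣ NumberField.discr N)), w P * Real.log (Ideal.absNorm P : ℝ) ≤
      (chebyshevPsiIdeal E x - chebyshevThetaIdeal E x) +
      ∑ P ∈ (finite_primeIdealsLE E x).toFinset with ¬ (Ideal.absNorm P).Prime, Real.log (Ideal.absNorm P : ℝ) +
      ∑ P ∈ (finite_primeIdealsLE E x).toFinset with ((Ideal.absNorm P).Prime ∧ ((Ideal.absNorm P : ℤ) ∣ NumberField.discr N)),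
        Real.log (Ideal.absNorm P : ℝ) := by
  classical
  rw [chebyshevPsiIdeal_eq_sum_vonMangoldtNorm, chebyshevThetaIdeal_eq_sum_primeIdealsLE E hx]
  set S := (finite_primeIdealsLE E x).toFinset with hS
  set U := (Icc 0 ⌊x⌋₊).biUnion (idealsOfNorm E) with hU
  have hdisj : Set.PairwiseDisjoint (↑(Icc 0 ⌊x⌋₊) : Set ℕ) (idealsOfNorm E) := by
    intro m _ n _ hmn
    rw [Function.onFun, Finset.disjoint_left]
    intro I hIm hIn
    rw [mem_idealsOfNorm] at hIm hIn
    exact hmn (hIm.symm.trans hIn)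
  have hsub : S ⊆ U := by
    intro P hP
    rw [hS, Set.Finite.mem_toFinset] at hP
    obtain ⟨-, -, hle⟩ := hP
    rw [hU, Finset.mem_biUnion]
    exact ⟨Ideal.absNorm P, mem_Icc.mpr ⟨Nat.zero_le _, Nat.le_floor hle⟩, by rw [mem_idealsOfNorm]⟩
  have hΛS : ∀ P ∈ S, idealVonMangoldt P = Real.log (Ideal.absNorm P : ℝ) := by
    intro P hP
    rw [hS, Set.Finite.mem_toFinset] at hP
    obtain ⟨hprime, hP0, -⟩ := hP
    have := idealVonMangoldt_prime_pow (Ideal.prime_of_isPrime hP0 hprime) one_ne_zero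
    rwa [pow_one] at this
  unfold vonMangoldtNorm
  rw [← Finset.sum_biUnion hdisj, ← Finset.sum_biUnion hdisj]
  -- the sums over subsets of `S`, as sums over `U` with indicators
  have hθ : ∑ P ∈ S, Real.log (Ideal.absNorm P : ℝ) = ∑ I ∈ U, if I ∈ S then idealVonMangoldt I else 0 := by
    rw [← Finset.sum_filter, Finset.filter_mem_eq_inter, Finset.inter_eq_right.mpr hsub]
    exact Finset.sum_congr rfl fun P hP ↦ (hΛS P hP).symm
  have hA : ∑ P ∈ S with ((Ideal.absNorm P).Prime ∧ ¬ ((Ideal.absNorm P : ℤ) ∣ NumberField.discr N)),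
      w P * Real.log (Ideal.absNorm P : ℝ) =
      ∑ I ∈ U, if (I ∈ S ∧ ((Ideal.absNorm I).Prime ∧ ¬ ((Ideal.absNorm I : ℤ) ∣ NumberField.discr N)))
        then w I * idealVonMangoldt I else 0 := by
    rw [← Finset.sum_filter]
    have : U.filter (fun I ↦ I ∈ S ∧ ((Ideal.absNorm I).Prime ∧ ¬ ((Ideal.absNorm I : ℤ) ∣ NumberField.discr N))) =
        S.filter (fun P ↦ (Ideal.absNorm P).Prime ∧ ¬ ((Ideal.absNorm P : ℤ) ∣ NumberField.discr N)) := by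
      ext I; simp only [Finset.mem_filter]
      exact ⟨fun h ↦ ⟨h.2.1, h.2.2⟩, fun h ↦ ⟨hsub h.1, h.1, h.2⟩⟩
    rw [this]
    exact Finset.sum_congr rfl fun P hP ↦ by rw [hΛS P (Finset.mem_filter.mp hP).1]
  have hB : ∑ P ∈ S with ¬ (Ideal.absNorm P).Prime, Real.log (Ideal.absNorm P : ℝ) =
      ∑ I ∈ U, if (I ∈ S ∧ ¬ (Ideal.absNorm I).Prime) then idealVonMangoldt I else 0 := by
    rw [← Finset.sum_filter]
    have : U.filter (fun I ↦ I ∈ S ∧ ¬ (Ideal.absNorm I).Prime) = S.filter (fun P ↦ ¬ (Ideal.absNorm P).Prime) := by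
      ext I; simp only [Finset.mem_filter]
      exact ⟨fun h ↦ ⟨h.2.1, h.2.2⟩, fun h ↦ ⟨hsub h.1, h.1, h.2⟩⟩
    rw [this]
    exact Finset.sum_congr rfl fun P hP ↦ (hΛS P (Finset.mem_filter.mp hP).1).symm
  have hC : ∑ P ∈ S with ((Ideal.absNorm P).Prime ∧ ((Ideal.absNorm P : ℤ) ∣ NumberField.discr N)),
      Real.log (Ideal.absNorm P : ℝ) =
      ∑ I ∈ U, if (I ∈ S ∧ ((Ideal.absNorm I).Prime ∧ ((Ideal.absNorm I : ℤ) ∣ NumberField.discr N)))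
        then idealVonMangoldt I else 0 := by
    rw [← Finset.sum_filter]
    have : U.filter (fun I ↦ I ∈ S ∧ ((Ideal.absNorm I).Prime ∧ ((Ideal.absNorm I : ℤ) ∣ NumberField.discr N))) =
        S.filter (fun P ↦ (Ideal.absNorm P).Prime ∧ ((Ideal.absNorm P : ℤ) ∣ NumberField.discr N)) := by
      ext I; simp only [Finset.mem_filter]
      exact ⟨fun h ↦ ⟨h.2.1, h.2.2⟩, fun h ↦ ⟨hsub h.1, h.1, h.2⟩⟩
    rw [this]
    exact Finset.sum_congr rfl fun P hP ↦ (hΛS P (Finset.mem_filter.mp hP).1).symm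
  rw [← hU, hA, hB, hC, hθ, ← Finset.sum_sub_distrib, ← Finset.sum_sub_distrib, ← Finset.sum_add_distrib,
    ← Finset.sum_add_distrib]
  constructor
  · refine Finset.sum_nonneg fun I _ ↦ ?_
    have hΛ := idealVonMangoldt_nonneg I
    have h0 := hw0 I
    split_ifs <;> nlinarith
  · refine Finset.sum_le_sum fun I _ ↦ ?_
    have hΛ := idealVonMangoldt_nonneg I
    have h0 := hw0 I
    have h1 := hw1 I
    have hwΛ : w I * idealVonMangoldt I ≤ idealVonMangoldt I := by nlinarith
    split_ifs <;> first | linarith | (exfalso; tauto)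

/-- **Deuring's reduction at one prime**: for `p ∤ d_N` prime with `p ≤ x` and the Frobenius weight `w_σ`
(`σ ∈ Gal(N/E)`, `Gal(N/E)` abelian),
`|Gal(N/E)| · Σ_{N𝔭 = p, N𝔭 ≤ x} w_σ(𝔭) = |C_G(σ)| · 𝟙[Frob_p ∈ C(σ)]`. -/
theorem card_aut_mul_sum_weight_eq (E : IntermediateField ℚ N) (hcomm : ∀ a b : N ≃ₐ[E] N, Commute a b)
    {σ : N ≃ₐ[ℚ] N} (hσ : σ ∈ E.fixingSubgroup) {w : Ideal (𝓞 E) → ℝ}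
    (hw : ∀ I, w I = if (∃ v : HeightOneSpectrum (𝓞 E), Algebra.IsUnramifiedIn (𝓞 N) v.asIdeal ∧
      ∃ k : ℕ, I = v.asIdeal ^ k ∧ galFrob E N v ^ k = IntermediateField.fixingSubgroupEquiv E ⟨σ, hσ⟩) then 1 else 0)
    {p : ℕ} (hp : p.Prime) (hd : ¬ ((p : ℤ) ∣ NumberField.discr N)) {x : ℝ} (hpx : (p : ℝ) ≤ x) :
    (Nat.card (N ≃ₐ[E] N) : ℝ) * ∑ P ∈ (finite_primeIdealsLE E x).toFinset with Ideal.absNorm P = p, w P =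
      (Nat.card (Subgroup.centralizer ({σ} : Set (N ≃ₐ[ℚ] N))) : ℝ) *
        (if ∃ (Q : Ideal (𝓞 N)) (_ : Q.IsMaximal) (_ : Q.LiesOver (span {(p : ℤ)})) (φ g : N ≃ₐ[ℚ] N),
            IsArithFrobAt ℤ φ Q ∧ Q.inertia (N ≃ₐ[ℚ] N) = ⊥ ∧ g * φ * g⁻¹ = σ then 1 else 0) := by
  classical
  set τ' : N ≃ₐ[E] N := IntermediateField.fixingSubgroupEquiv E ⟨σ, hσ⟩ with hτ'
  set S := (finite_primeIdealsLE E x).toFinset with hS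
  -- every prime of `E` above `p` is unramified in `N`
  have hunr : ∀ v : HeightOneSpectrum (𝓞 E), (p : 𝓞 E) ∈ v.asIdeal → Algebra.IsUnramifiedIn (𝓞 N) v.asIdeal := by
    intro v hpv
    by_contra hram
    exact hd (dvd_discr_of_not_isUnramifiedIn (N := N) v hp hpv hram)
  -- the weight at a prime `P` with `N P = p`: `𝟙[Frob P = τ']`
  have hwP : ∀ P ∈ S.filter (fun P ↦ Ideal.absNorm P = p),
      w P = if (∃ v : HeightOneSpectrum (𝓞 E), v.asIdeal = P ∧ galFrob E N v = τ') then 1 else 0 := by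
    intro P hP
    rw [Finset.mem_filter, hS, Set.Finite.mem_toFinset] at hP
    obtain ⟨⟨hprime, hP0, -⟩, hNP⟩ := hP
    set vP : HeightOneSpectrum (𝓞 E) := ⟨P, hprime, hP0⟩ with hvP
    have hpP : (p : 𝓞 E) ∈ P := by rw [← hNP]; exact Ideal.absNorm_mem P
    rw [hw P]
    have hiff : (∃ v : HeightOneSpectrum (𝓞 E), Algebra.IsUnramifiedIn (𝓞 N) v.asIdeal ∧
        ∃ k : ℕ, P = v.asIdeal ^ k ∧ galFrob E N v ^ k = τ') ↔
        (∃ v : HeightOneSpectrum (𝓞 E), v.asIdeal = P ∧ galFrob E N v = τ') := by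
      constructor
      · rintro ⟨v, -, k, hPk, hk⟩
        obtain ⟨hvv, hk1⟩ := heightOneSpectrum_pow_eq_pow (v := vP) (v' := v) (m := 1) (k := k) one_pos
          (by rw [pow_one]; exact hPk)
        refine ⟨v, by rw [← hvv], ?_⟩
        rw [← hk1, pow_one] at hk
        exact hk
      · rintro ⟨v, hv, hfrob⟩
        refine ⟨v, hunr v (by rw [hv]; exact hpP), 1, by rw [pow_one, hv], by rw [pow_one, hfrob]⟩
    by_cases h : ∃ v : HeightOneSpectrum (𝓞 E), v.asIdeal = P ∧ galFrob E N v = τ'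
    · rw [if_pos h, if_pos (hiff.mpr h)]
    · rw [if_neg h, if_neg (fun h' ↦ h (hiff.mp h'))]
  rw [Finset.sum_congr rfl hwP, Finset.sum_boole]
  -- the count of the good primes above `p`
  have hcount : ((S.filter (fun P ↦ Ideal.absNorm P = p)).filter
      (fun P ↦ ∃ v : HeightOneSpectrum (𝓞 E), v.asIdeal = P ∧ galFrob E N v = τ')).card =
      Nat.card {v : HeightOneSpectrum (𝓞 E) // (p : 𝓞 E) ∈ v.asIdeal ∧ Ideal.absNorm v.asIdeal = p ∧
        galFrob E N v = τ'} := by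
    rw [← Nat.card_eq_finsetCard]
    symm
    refine Nat.card_eq_of_bijective (fun v ↦ ⟨v.1.asIdeal, ?_⟩) ⟨?_, ?_⟩
    · rw [Finset.mem_filter, Finset.mem_filter, hS, Set.Finite.mem_toFinset]
      exact ⟨⟨⟨v.1.isPrime, v.1.ne_bot, by rw [v.2.2.1]; exact hpx⟩, v.2.2.1⟩, ⟨v.1, rfl, v.2.2.2⟩⟩
    · intro v v' hvv
      apply Subtype.ext
      apply HeightOneSpectrum.ext
      exact congrArg (fun P : {P : Ideal (𝓞 E) // P ∈ (S.filter (fun P ↦ Ideal.absNorm P = p)).filter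
        (fun P ↦ ∃ v : HeightOneSpectrum (𝓞 E), v.asIdeal = P ∧ galFrob E N v = τ')} ↦ (P.1 : Ideal (𝓞 E))) hvv
    · rintro ⟨P, hP⟩
      obtain ⟨hP1, ⟨v, hv, hfrob⟩⟩ := Finset.mem_filter.mp hP
      obtain ⟨-, hNP⟩ := Finset.mem_filter.mp hP1
      have hpv : (p : 𝓞 E) ∈ v.asIdeal := by rw [hv, ← hNP]; exact Ideal.absNorm_mem P
      exact ⟨⟨v, hpv, by rw [hv]; exact hNP, hfrob⟩, Subtype.ext hv⟩
  rw [hcount]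
  -- Deuring's count
  split_ifs with hcl
  · obtain ⟨Q, hQmax, hQover, φ, g, hφ, hI, hg⟩ := hcl
    haveI := hQmax
    haveI := hQover
    have key := card_aut_mul_card_degOneFrobPrimes_eq E hcomm hp Q hφ hI hunr hσ
    rw [natCard_conj_eq_card_centralizer hg] at key
    rw [mul_one]
    exact_mod_cast key
  · obtain ⟨Q₀, hQ₀max, hQ₀over, ⟨φ₀, hφ₀⟩, hI₀⟩ := exists_isArithFrobAt_of_not_dvd_discr (N := N) hp hd
    haveI := hQ₀max
    haveI := hQ₀over
    have key := card_aut_mul_card_degOneFrobPrimes_eq E hcomm hp Q₀ hφ₀ hI₀ hunr hσ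
    have h0 : Nat.card {g : N ≃ₐ[ℚ] N // g * φ₀ * g⁻¹ = σ} = 0 := by
      refine natCard_conj_eq_zero_of_forall fun g hg ↦ hcl ⟨Q₀, hQ₀max, hQ₀over, φ₀, g, hφ₀, hI₀, hg⟩
    rw [h0, Nat.mul_eq_zero] at key
    rcases key with h | h
    · exact absurd h Nat.card_pos.ne'
    · rw [h, Nat.cast_zero, mul_zero, mul_zero]

/-- **Deuring's reduction, summed over `p ≤ x`**:
`|Gal(N/E)| · Σ_{N𝔭 = p ≤ x prime, p ∤ d_N} w_σ(𝔭) log N𝔭 = |C_G(σ)| · Σ_{p ≤ x, p ∤ d_N, Frob_p ∈ C(σ)} log p`. -/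
theorem card_aut_mul_degOneSum_eq (E : IntermediateField ℚ N) (hcomm : ∀ a b : N ≃ₐ[E] N, Commute a b)
    {σ : N ≃ₐ[ℚ] N} (hσ : σ ∈ E.fixingSubgroup) {w : Ideal (𝓞 E) → ℝ}
    (hw : ∀ I, w I = if (∃ v : HeightOneSpectrum (𝓞 E), Algebra.IsUnramifiedIn (𝓞 N) v.asIdeal ∧
      ∃ k : ℕ, I = v.asIdeal ^ k ∧ galFrob E N v ^ k = IntermediateField.fixingSubgroupEquiv E ⟨σ, hσ⟩) then 1 else 0)
    (x : ℝ) :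
    (Nat.card (N ≃ₐ[E] N) : ℝ) *
        ∑ P ∈ (finite_primeIdealsLE E x).toFinset with
          ((Ideal.absNorm P).Prime ∧ ¬ ((Ideal.absNorm P : ℤ) ∣ NumberField.discr N)), w P * Real.log (Ideal.absNorm P : ℝ) =
      (Nat.card (Subgroup.centralizer ({σ} : Set (N ≃ₐ[ℚ] N))) : ℝ) *
        ∑ p ∈ (Nat.primesLE ⌊x⌋₊).filter
          (fun p : ℕ => ¬ ((p : ℤ) ∣ NumberField.discr N) ∧
            ∃ (Q : Ideal (𝓞 N)) (_ : Q.IsMaximal) (_ : Q.LiesOver (span {(p : ℤ)})) (φ g : N ≃ₐ[ℚ] N),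
              IsArithFrobAt ℤ φ Q ∧ Q.inertia (N ≃ₐ[ℚ] N) = ⊥ ∧ g * φ * g⁻¹ = σ), Real.log p := by
  classical
  set S := (finite_primeIdealsLE E x).toFinset with hS
  set T := S.filter (fun P ↦ (Ideal.absNorm P).Prime ∧ ¬ ((Ideal.absNorm P : ℤ) ∣ NumberField.discr N)) with hT
  set R := (Nat.primesLE ⌊x⌋₊).filter (fun p : ℕ ↦ ¬ ((p : ℤ) ∣ NumberField.discr N)) with hR
  set Pcl : ℕ → Prop := fun p ↦ ∃ (Q : Ideal (𝓞 N)) (_ : Q.IsMaximal) (_ : Q.LiesOver (span {(p : ℤ)}))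
    (φ g : N ≃ₐ[ℚ] N), IsArithFrobAt ℤ φ Q ∧ Q.inertia (N ≃ₐ[ℚ] N) = ⊥ ∧ g * φ * g⁻¹ = σ with hPcl
  -- `absNorm` maps `T` into `R`
  have hmaps : ∀ P ∈ T, Ideal.absNorm P ∈ R := by
    intro P hP
    rw [hT, Finset.mem_filter, hS, Set.Finite.mem_toFinset] at hP
    obtain ⟨⟨-, -, hle⟩, hprime, hnd⟩ := hP
    rw [hR, Finset.mem_filter, Nat.mem_primesLE]
    exact ⟨⟨Nat.le_floor hle, hprime⟩, hnd⟩
  rw [← Finset.sum_fiberwise_of_maps_to hmaps, Finset.mul_sum]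
  -- the right-hand side as a sum over `R`
  have hRHS : ∑ p ∈ (Nat.primesLE ⌊x⌋₊).filter (fun p : ℕ => ¬ ((p : ℤ) ∣ NumberField.discr N) ∧ Pcl p), Real.log p =
      ∑ p ∈ R, (if Pcl p then 1 else 0) * Real.log p := by
    rw [hR, Finset.sum_filter, Finset.sum_filter]
    refine Finset.sum_congr rfl fun p _ ↦ ?_
    by_cases h1 : ((p : ℤ) ∣ NumberField.discr N)
    · rw [if_neg (fun h ↦ h.1 h1), if_neg (fun h ↦ h h1)]
    · rw [if_pos h1]
      by_cases h2 : Pcl p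
      · rw [if_pos ⟨h1, h2⟩, if_pos h2, one_mul]
      · rw [if_neg (fun h ↦ h2 h.2), if_neg h2, zero_mul]
  rw [hRHS, Finset.mul_sum]
  refine Finset.sum_congr rfl fun p hp ↦ ?_
  rw [hR, Finset.mem_filter, Nat.mem_primesLE] at hp
  obtain ⟨⟨hple, hprime⟩, hnd⟩ := hp
  have hpx : (p : ℝ) ≤ x := by
    have h1 : ((⌊x⌋₊ : ℕ) : ℝ) ≤ x := by
      rcases le_or_gt 0 x with hx | hx
      · exact Nat.floor_le hx
      · have : ⌊x⌋₊ = 0 := Nat.floor_eq_zero.mpr (by linarith)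
        rw [this] at hple
        have : p = 0 := Nat.le_zero.mp hple
        exact absurd this hprime.ne_zero
    exact le_trans (by exact_mod_cast hple) h1
  -- the fibre `{P ∈ T : N P = p}` is `{P ∈ S : N P = p}`, and on it `log N P = log p`
  have hfib : T.filter (fun P ↦ Ideal.absNorm P = p) = S.filter (fun P ↦ Ideal.absNorm P = p) := by
    rw [hT, Finset.filter_filter]
    refine Finset.filter_congr fun P _ ↦ ⟨fun h ↦ h.2, fun h ↦ ⟨⟨by rw [h]; exact hprime, by rw [h]; exact hnd⟩, h⟩⟩
  have hsum : ∑ P ∈ T.filter (fun P ↦ Ideal.absNorm P = p), w P * Real.log (Ideal.absNorm P : ℝ) =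
      (∑ P ∈ S.filter (fun P ↦ Ideal.absNorm P = p), w P) * Real.log p := by
    rw [hfib, Finset.sum_mul]
    refine Finset.sum_congr rfl fun P hP ↦ ?_
    rw [(Finset.mem_filter.mp hP).2]
  rw [hsum, ← mul_assoc, card_aut_mul_sum_weight_eq E hcomm hσ hw hprime hnd hpx, mul_assoc]

/-- **`|m ψ_σ(x) − |C_G(σ)| S_C(x)|` is small**: for the Frobenius weight `w_σ` of `E` (`Gal(N/E)` abelian of
order `m`, `σ ∈ Gal(N/E)`) and `x ≥ 1`,
`|m ψ_{w_σ}(x) − |C_G(σ)| Σ_{p ≤ x, p ∤ d_N, Frob_p ∈ C(σ)} log p| ≤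
 m((ψ_E − θ_E)(x) + [E:ℚ](√x + 1) log x + [E:ℚ] ω(d_N) log|d_N|)`. [cite: LagariasMontgomeryOdlyzko1979, §3] -/
theorem abs_card_mul_psiFrob_sub_le (E : IntermediateField ℚ N) (hcomm : ∀ a b : N ≃ₐ[E] N, Commute a b)
    {σ : N ≃ₐ[ℚ] N} (hσ : σ ∈ E.fixingSubgroup) {w : Ideal (𝓞 E) → ℝ}
    (hw : ∀ I, w I = if (∃ v : HeightOneSpectrum (𝓞 E), Algebra.IsUnramifiedIn (𝓞 N) v.asIdeal ∧
      ∃ k : ℕ, I = v.asIdeal ^ k ∧ galFrob E N v ^ k = IntermediateField.fixingSubgroupEquiv E ⟨σ, hσ⟩) then 1 else 0)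
    {x : ℝ} (hx : 1 ≤ x) :
    |(Nat.card (N ≃ₐ[E] N) : ℝ) * (∑ n ∈ Icc 0 ⌊x⌋₊, ∑ I ∈ idealsOfNorm E n, w I * idealVonMangoldt I) -
      (Nat.card (Subgroup.centralizer ({σ} : Set (N ≃ₐ[ℚ] N))) : ℝ) *
        ∑ p ∈ (Nat.primesLE ⌊x⌋₊).filter
          (fun p : ℕ => ¬ ((p : ℤ) ∣ NumberField.discr N) ∧
            ∃ (Q : Ideal (𝓞 N)) (_ : Q.IsMaximal) (_ : Q.LiesOver (span {(p : ℤ)})) (φ g : N ≃ₐ[ℚ] N),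
              IsArithFrobAt ℤ φ Q ∧ Q.inertia (N ≃ₐ[ℚ] N) = ⊥ ∧ g * φ * g⁻¹ = σ), Real.log p| ≤
      (Nat.card (N ≃ₐ[E] N) : ℝ) * ((chebyshevPsiIdeal E x - chebyshevThetaIdeal E x) +
        Module.finrank ℚ E * (Real.sqrt x + 1) * Real.log x +
        Module.finrank ℚ E * ((NumberField.discr N).natAbs.primeFactors.card) *
          Real.log ((NumberField.discr N).natAbs : ℝ)) := by
  have hw0 : ∀ I, 0 ≤ w I := fun I ↦ by rw [hw I]; split_ifs <;> norm_num
  have hw1 : ∀ I, w I ≤ 1 := fun I ↦ by rw [hw I]; split_ifs <;> norm_num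
  rw [← card_aut_mul_degOneSum_eq E hcomm hσ hw x, ← mul_sub, abs_mul, abs_of_nonneg (Nat.cast_nonneg _)]
  refine mul_le_mul_of_nonneg_left ?_ (Nat.cast_nonneg _)
  obtain ⟨hlo, hhi⟩ := psiWeighted_degOne_sandwich (N := N) E hw0 hw1 (by linarith : (0 : ℝ) ≤ x)
  have h2 := sum_log_absNorm_not_prime_le (E := E) hx
  have h3 := sum_log_absNorm_prime_dvd_le (E := E) (N := N) x
  rw [abs_of_nonneg hlo]
  linarith

end Primes

end Summit.QuantumAdvantage.QuantumAdvantage.Theorems.DegreeOnePrimesEscape
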